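import Summits.Schanuel.Schanuel.Theorems.ZilberEacExplosionExistence
import Summits.Schanuel.Schanuel.Theorems.ZilberEacExplosionDominance
import HarnessLib

/-!
# Zariski density over EVERY graph hypersurface of degree `≥ 2` in a non-degenerate balance
# direction — the EXPLOSION regime in dimension `≥ 3` included

Zilber's Exponential-Algebraic Closedness, case ladder (host summit Schanuel, cell `pub-schanuel`,
seat 2, gen 10).  **THEOREM (`unprojectedDense_polyFibredGraph_balance`).**  Let
`g ∈ ℂ[x₀, …, x_s]` have degree `D ≥ 2`, `Aⱼ ∈ ℂ[x₀, …, x_s]` ARBITRARY, `fⱼ ∈ ℂ[u] ∖ 0`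
(`j = 0, …, s`) with `eⱼ = 1 + deg fⱼ`, and assume the balance direction is non-degenerate:
`g_D(e₀, …, e_s) ≠ 0`.  Then the exponential points of the `(s+2)`-fold

  `W = {x_{s+1} = g(x), yⱼ = Aⱼ(x) + y_{s+1} fⱼ(y_{s+1})} ⊆ ℂ^{s+2} × ℂ^{s+2}`
  (`polyFibredGraph g A (fⱼ.toMvPolynomial 0)`; solutions of `e^{xⱼ} = Aⱼ(x) + e^{g(x)}fⱼ(e^{g(x)})`)

are ZARISKI DENSE: `I(W ∩ Γ_exp) = I(W)`.  NO SIGN CONDITION on `g`: the puncture regime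
(`Re g_D(2πiq) < 0` for some `q`, gen 9), the oscillatory regime, AND the EXPLOSION regime
(`Re g_D(2πiq) > 0` for all `q`, e.g. `x₂ = -(x₀² + x₁²)`, the last open regime of O50(b)) are
covered uniformly by the several-variable exp–exp balance (`ZilberEacExplosionExistence`) and
THEOREM K (`ZilberEacExplosionDominance`).  With `A` dominant these `W` are certified members of
`EC(s+2, s+1)` (`polyFibredGraph_balance_member_dense`); flagship in `EC(3,2)`:
`{x₂ = -(x₀² + x₁²), y₀ = x₀ + y₂, y₁ = x₁ + y₂}` (`e^z = z + e^{-(z²+w²)}`,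
`e^w = w + e^{-(z²+w²)}`): certified member, not linearly split, `W ∩ Γ_exp ≠ ∅` and dense
(`negSumSquares_member_dense`).  The degenerate directions `g_D(e) = 0` (e.g. Mantova–Masser's
`x₀² - x₁²` with `e = (1,1)`) are exactly where the balance line lies in the null cone; those
families were settled by the puncture theorem when a negative ray exists.

HONEST FRAMING: explicit families inside the OPEN cell `EC(3,2)`; EC(3,2) itself, the free density
question ⟺ Fib(3,2) and Zilber's EAC remain OPEN; NOT Schanuel's conjecture; EAC ⇏ SC.
-/

noncomputable section

open Complex MvPolynomial Filter Topology
open Literature.NumberTheory.Transcendental Literature.ModelTheory.Zilber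
  Literature.ModelTheory.ExponentialFields

set_option linter.dupNamespace false

namespace Summit.Schanuel.Schanuel.Theorems

section Balance

variable {s : ℕ}

/-- The line `z ↦ (z, λz + ν)` written as `z • b + a` with `b = (1, λ)`, `a = (0, ν)`. [folklore] -/
theorem cons_line_eq_smul_add (lam ν : Fin s → ℂ) (z : ℂ) :
    (Fin.cons z (fun j => lam j * z + ν j) : Fin (s + 1) → ℂ) =
      z • (Fin.cons 1 lam : Fin (s + 1) → ℂ) + (Fin.cons 0 ν : Fin (s + 1) → ℂ) := by
  funext i
  refine Fin.cases ?_ (fun j => ?_) i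
  · simp
  · simp [mul_comm]

/-- **THEOREM (density for every graph base of degree `≥ 2` in a non-degenerate balance
direction; the explosion regime included).**  See the module docstring. (new)
[cite: MantovaMasser2023, §1 p.5 (the open case dim π(V) = 2 in ℂ³×ℂˣ³)] -/
theorem unprojectedDense_polyFibredGraph_balance (g : MvPolynomial (Fin (s + 1)) ℂ)
    (hD : 2 ≤ g.totalDegree) (A : Fin (s + 1) → MvPolynomial (Fin (s + 1)) ℂ)
    (f : Fin (s + 1) → Polynomial ℂ) (hf : ∀ j, f j ≠ 0)
    (hdir : eval (fun j => (((f j).natDegree + 1 : ℕ) : ℂ))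
      (homogeneousComponent g.totalDegree g) ≠ 0) :
    UnprojectedDense (polyFibredGraph g A (fun j => (f j).toMvPolynomial 0)) := by
  classical
  -- slopes, logarithms of the leading coefficients, the offset family
  set lam : Fin s → ℂ := fun j =>
    ((((f j.succ).natDegree + 1 : ℕ) : ℝ) / (((f 0).natDegree + 1 : ℕ) : ℝ) : ℝ) with hlam
  set Λ : Fin (s + 1) → ℂ := fun j => log (f j).leadingCoeff with hΛ
  have hΛexp : ∀ j, exp (Λ j) = (f j).leadingCoeff := fun j =>
    Complex.exp_log (Polynomial.leadingCoeff_ne_zero.2 (hf j))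
  set νof : (Fin (s + 1) → ℤ) → Fin s → ℂ := fun m j =>
    lam j * (2 * Real.pi * I * m 0 - Λ 0) - (2 * Real.pi * I * m j.succ - Λ j.succ) with hνof
  set M : Set (Fin s → ℂ) := Set.range νof with hM
  have he0 : (0 : ℝ) < (((f 0).natDegree + 1 : ℕ) : ℝ) := by exact_mod_cast Nat.succ_pos _
  -- the direction `b = (1, λ)` is non-degenerate: `g_D(e) = e₀^D g_D(b)`
  have hb : eval (Fin.cons 1 lam : Fin (s + 1) → ℂ) (homogeneousComponent g.totalDegree g) ≠ 0 := by
    intro h0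
    apply hdir
    have hsmul : (fun j => (((f j).natDegree + 1 : ℕ) : ℂ)) =
        ((((f 0).natDegree + 1 : ℕ) : ℂ)) • (Fin.cons 1 lam : Fin (s + 1) → ℂ) := by
      funext j
      refine Fin.cases ?_ (fun i => ?_) j
      · simp
      · simp only [Pi.smul_apply, Fin.cons_succ, smul_eq_mul, hlam]
        push_cast
        field_simp
    rw [hsmul, (homogeneousComponent_isHomogeneous _ _).eval_smul_eq, h0, mul_zero]
  refine unprojectedDense_polyFibredGraph_of_nearLine g A _ lam M (fun R hR => ?_) ?_
  · -- `M ⊇ κ - 2πi ℤ^s` is Zariski dense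
    obtain ⟨q, hq⟩ := exists_int_eval_translate_ne_zero hR (fun j => Λ j.succ - lam j * Λ 0)
      (a := -(2 * Real.pi * I)) (neg_ne_zero.2 (mul_ne_zero (mul_ne_zero two_ne_zero
        (Complex.ofReal_ne_zero.2 Real.pi_ne_zero)) Complex.I_ne_zero))
    refine ⟨νof (Fin.cons 0 q), ⟨_, rfl⟩, ?_⟩
    have hν : νof (Fin.cons 0 q) = fun j => Λ j.succ - lam j * Λ 0 + -(2 * Real.pi * I) * (q j : ℂ) := by
      funext j
      simp only [hνof, Fin.cons_zero, Fin.cons_succ, Int.cast_zero, mul_zero, zero_sub]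
      ring
    rw [hν]
    exact hq
  · rintro ν ⟨m, rfl⟩
    -- the restriction of `g` to the line
    set θ : Fin (s + 1) → Polynomial ℂ :=
      Fin.cons Polynomial.X (fun j => Polynomial.C (lam j) * Polynomial.X + Polynomial.C (νof m j))
      with hθ
    set p : Polynomial ℂ := aeval θ g with hp
    have hpeval : ∀ z, p.eval z =
        eval (Fin.cons z (fun j => lam j * z + νof m j) : Fin (s + 1) → ℂ) g := by
      intro z
      rw [hp, polynomial_eval_aeval]
      have hfun : (fun i => (θ i).eval z) = (Fin.cons z (fun j => lam j * z + νof m j) : Fin (s + 1) → ℂ) := by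
        funext i
        refine Fin.cases ?_ (fun j => ?_) i
        · simp [hθ]
        · simp [hθ]
      rw [hfun]
    have hp2 : 2 ≤ p.natDegree :=
      two_le_natDegree_of_lineRestrict g hD (Fin.cons 1 lam) (Fin.cons 0 (νof m)) hb p
        (fun z => by rw [hpeval, cons_line_eq_smul_add])
    obtain ⟨z, x, hz, hsol, hdist, hgrow⟩ := exists_solutions_nearLine g A f hf Λ hΛexp lam
      (fun j => rfl) m (νof m) (fun j => rfl) p hp2 hpeval
    refine ⟨z, x, hz, ?_, hdist, hgrow⟩
    filter_upwards [hsol] with i hi j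
    rw [hi j, MvPolynomial.eval_toMvPolynomial, Fin.cons_zero]

/-- **Certified members with dense exponential points.**  `A` dominant (`aeval A` injective),
`deg g ≥ 2`, all `fⱼ ≠ 0`, non-degenerate balance direction: the `(s+2)`-fold satisfies all seven
hypotheses of `ECCell (s+2) (s+1)`, is not linearly split, meets `Γ_exp`, and
`I(W ∩ Γ_exp) = I(W)`. (new) [cite: MantovaMasser2023, §1 p.5 (the open case dim π(V) = 2 in ℂ³×ℂˣ³)] -/
theorem polyFibredGraph_balance_member_dense (g : MvPolynomial (Fin (s + 1)) ℂ)
    (hg : 2 ≤ g.totalDegree) (A : Fin (s + 1) → MvPolynomial (Fin (s + 1)) ℂ)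
    (hA : Function.Injective (aeval A : MvPolynomial (Fin (s + 1)) ℂ →ₐ[ℂ] MvPolynomial (Fin (s + 1)) ℂ))
    (f : Fin (s + 1) → Polynomial ℂ) (hf : ∀ j, f j ≠ 0)
    (hdir : eval (fun j => (((f j).natDegree + 1 : ℕ) : ℂ))
      (homogeneousComponent g.totalDegree g) ≠ 0) :
    (IsIrreducibleClosed ℂ (polyFibredGraph g A (fun j => (f j).toMvPolynomial 0)) ∧
      (polyFibredGraph g A (fun j => (f j).toMvPolynomial 0) ∩ torusLocus ℂ (s + 2)).Nonempty ∧
      IsRotund ℂ (s + 2) (polyFibredGraph g A (fun j => (f j).toMvPolynomial 0) ∩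
        torusLocus ℂ (s + 2)) ∧
      IsAddFree ℂ (s + 2) (polyFibredGraph g A (fun j => (f j).toMvPolynomial 0) ∩
        torusLocus ℂ (s + 2)) ∧
      IsMulFree ℂ (s + 2) (polyFibredGraph g A (fun j => (f j).toMvPolynomial 0) ∩
        torusLocus ℂ (s + 2)) ∧
      zariskiDim ℂ (polyFibredGraph g A (fun j => (f j).toMvPolynomial 0)) = (s + 2 : ℕ) ∧
      addProjDim ℂ (s + 2) (polyFibredGraph g A (fun j => (f j).toMvPolynomial 0)) = (s + 1 : ℕ)) ∧
    ¬ IsLinearSplit ℂ (s + 2) (polyFibredGraph g A (fun j => (f j).toMvPolynomial 0)) ∧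
    (polyFibredGraph g A (fun j => (f j).toMvPolynomial 0) ∩ expGraph ℂ (s + 2)).Nonempty ∧
    UnprojectedDense (polyFibredGraph g A (fun j => (f j).toMvPolynomial 0)) := by
  have hcell := ecCell_hypotheses_polyFibredGraph g A (fun j => (f j).toMvPolynomial 0) hA hg
  have hdense := unprojectedDense_polyFibredGraph_balance g hg A f hf hdir
  refine ⟨hcell, not_isLinearSplit_polyFibredGraph g A _ (Nat.succ_pos s) hA, ?_, hdense⟩
  obtain ⟨w, hw, -⟩ := hcell.2.1
  exact inter_expGraph_nonempty_of_vanishingIdeal_eq ⟨w, hw⟩ hdense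

end Balance

/-! ## The flagship member of `EC(3,2)` in the explosion regime: `x₂ = -(x₀² + x₁²)` -/

section Example

/-- Data of the explosion base: `g = -(X₀² + X₁²)` has degree `2`, `g_D(1,1) = -2 ≠ 0`, and
`Re g_D(2πi q) = 4π²(q₀² + q₁²) ≥ 0` for every lattice direction (no negative ray). [folklore] -/
theorem negSumSquares_data :
    (-(X 0 ^ 2 + X 1 ^ 2) : MvPolynomial (Fin 2) ℂ).totalDegree = 2 ∧
    eval (fun _ => (((0 : ℕ) + 1 : ℕ) : ℂ)) (homogeneousComponent
      (-(X 0 ^ 2 + X 1 ^ 2) : MvPolynomial (Fin 2) ℂ).totalDegree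
      (-(X 0 ^ 2 + X 1 ^ 2) : MvPolynomial (Fin 2) ℂ)) ≠ 0 ∧
    ∀ q : Fin 2 → ℤ, 0 ≤ (eval (fun j => 2 * Real.pi * I * (q j : ℂ)) (homogeneousComponent
      (-(X 0 ^ 2 + X 1 ^ 2) : MvPolynomial (Fin 2) ℂ).totalDegree
      (-(X 0 ^ 2 + X 1 ^ 2) : MvPolynomial (Fin 2) ℂ))).re := by
  set g : MvPolynomial (Fin 2) ℂ := -(X 0 ^ 2 + X 1 ^ 2) with hg
  have hhom : g.IsHomogeneous 2 := ((isHomogeneous_X_pow 0 2).add (isHomogeneous_X_pow 1 2)).neg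
  have heval : ∀ x : Fin 2 → ℂ, eval x g = -(x 0 ^ 2 + x 1 ^ 2) := fun x => by
    simp [hg, map_add, map_pow, eval_X]
  have hg0 : g ≠ 0 := by
    intro h
    have := heval ![1, 0]
    rw [h, map_zero] at this
    norm_num at this
  have hdeg : g.totalDegree = 2 := hhom.totalDegree hg0
  refine ⟨hdeg, ?_, fun q => ?_⟩
  · rw [hdeg, homogeneousComponent_eq_self hhom, heval]
    norm_num
  · rw [hdeg, homogeneousComponent_eq_self hhom, heval]
    have h1 : -((2 * (Real.pi : ℂ) * I * (q 0 : ℂ)) ^ 2 + (2 * Real.pi * I * (q 1 : ℂ)) ^ 2) =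
        ((4 * Real.pi ^ 2 * ((q 0 : ℝ) ^ 2 + (q 1 : ℝ) ^ 2) : ℝ) : ℂ) := by
      push_cast
      ring_nf
      rw [Complex.I_sq]
      ring
    rw [h1, Complex.ofReal_re]
    positivity

/-- **The flagship explosion-regime member of `EC(3,2)`**:
`W = {x₂ = -(x₀² + x₁²), y₀ = x₀ + y₂, y₁ = x₁ + y₂} ⊆ ℂ³ × ℂ³`, exponential points = solutions of
`e^z = z + e^{-(z² + w²)}`, `e^w = w + e^{-(z² + w²)}`: all seven hypotheses of `ECCell 3 2`, not
linearly split, `W ∩ Γ_exp ≠ ∅` AND `I(W ∩ Γ_exp) = I(W)` — over a base with NO negative and NO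
oscillatory lattice ray (`Re g_D(2πiq) = 4π²|q|² > 0`), outside every earlier theorem of the cell.
(new) [cite: MantovaMasser2023, §1 p.5 (the open case dim π(V) = 2 in ℂ³×ℂˣ³)] -/
theorem negSumSquares_member_dense :
    (IsIrreducibleClosed ℂ (polyFibredGraph (-(X 0 ^ 2 + X 1 ^ 2) : MvPolynomial (Fin 2) ℂ)
        (fun j => X j) (fun _ => 1)) ∧
      (polyFibredGraph (-(X 0 ^ 2 + X 1 ^ 2) : MvPolynomial (Fin 2) ℂ) (fun j => X j) (fun _ => 1) ∩
        torusLocus ℂ 3).Nonempty ∧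
      IsRotund ℂ 3 (polyFibredGraph (-(X 0 ^ 2 + X 1 ^ 2) : MvPolynomial (Fin 2) ℂ) (fun j => X j)
        (fun _ => 1) ∩ torusLocus ℂ 3) ∧
      IsAddFree ℂ 3 (polyFibredGraph (-(X 0 ^ 2 + X 1 ^ 2) : MvPolynomial (Fin 2) ℂ) (fun j => X j)
        (fun _ => 1) ∩ torusLocus ℂ 3) ∧
      IsMulFree ℂ 3 (polyFibredGraph (-(X 0 ^ 2 + X 1 ^ 2) : MvPolynomial (Fin 2) ℂ) (fun j => X j)
        (fun _ => 1) ∩ torusLocus ℂ 3) ∧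
      zariskiDim ℂ (polyFibredGraph (-(X 0 ^ 2 + X 1 ^ 2) : MvPolynomial (Fin 2) ℂ) (fun j => X j)
        (fun _ => 1)) = (3 : ℕ) ∧
      addProjDim ℂ 3 (polyFibredGraph (-(X 0 ^ 2 + X 1 ^ 2) : MvPolynomial (Fin 2) ℂ) (fun j => X j)
        (fun _ => 1)) = (2 : ℕ)) ∧
    ¬ IsLinearSplit ℂ 3 (polyFibredGraph (-(X 0 ^ 2 + X 1 ^ 2) : MvPolynomial (Fin 2) ℂ)
        (fun j => X j) (fun _ => 1)) ∧
    (polyFibredGraph (-(X 0 ^ 2 + X 1 ^ 2) : MvPolynomial (Fin 2) ℂ) (fun j => X j) (fun _ => 1) ∩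
        expGraph ℂ 3).Nonempty ∧
    UnprojectedDense (polyFibredGraph (-(X 0 ^ 2 + X 1 ^ 2) : MvPolynomial (Fin 2) ℂ)
        (fun j => X j) (fun _ => 1)) := by
  obtain ⟨hdeg, hdir, -⟩ := negSumSquares_data
  have hA : Function.Injective (aeval (fun j : Fin 2 => (X j : MvPolynomial (Fin 2) ℂ)) :
      MvPolynomial (Fin 2) ℂ →ₐ[ℂ] MvPolynomial (Fin 2) ℂ) := by
    rw [aeval_X_left]; exact fun _ _ h => h
  have hF : (fun _ : Fin 2 => (1 : MvPolynomial (Fin 3) ℂ)) =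
      fun j : Fin 2 => ((fun _ : Fin 2 => (1 : Polynomial ℂ)) j).toMvPolynomial 0 := by
    funext j; simp
  have hdir' : eval (fun j : Fin 2 => ((((fun _ : Fin 2 => (1 : Polynomial ℂ)) j).natDegree + 1 : ℕ) : ℂ))
      (homogeneousComponent (-(X 0 ^ 2 + X 1 ^ 2) : MvPolynomial (Fin 2) ℂ).totalDegree
        (-(X 0 ^ 2 + X 1 ^ 2) : MvPolynomial (Fin 2) ℂ)) ≠ 0 := by
    simpa only [Polynomial.natDegree_one] using hdir
  rw [hF]
  exact polyFibredGraph_balance_member_dense _ (by rw [hdeg]) _ hA _ (fun _ => one_ne_zero) hdir'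

/-- The flagship system is solvable: `∃ z w, e^z = z + e^{-(z²+w²)} ∧ e^w = w + e^{-(z²+w²)}`. (new)
[cite: MantovaMasser2023, §1 p.5 (the open case dim π(V) = 2 in ℂ³×ℂˣ³)] -/
theorem exists_exp_eq_self_add_exp_neg_sum_sq :
    ∃ z w : ℂ, exp z = z + exp (-(z ^ 2 + w ^ 2)) ∧ exp w = w + exp (-(z ^ 2 + w ^ 2)) := by
  obtain ⟨-, -, ⟨p, hp, hexp⟩, -⟩ := negSumSquares_member_dense
  rw [mem_polyFibredGraph_iff] at hp
  rw [mem_expGraph_iff] at hexp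
  obtain ⟨hbase, hfib⟩ := hp
  have e0 := hexp (Fin.castSucc (0 : Fin 2))
  have e1 := hexp (Fin.castSucc (1 : Fin 2))
  have e2 := hexp (Fin.last 2)
  rw [ExponentialRing.complex_exp_eq] at e0 e1 e2
  have h0 := hfib 0
  have h1 := hfib 1
  simp only [map_neg, map_add, map_pow, eval_X, map_one, mul_one] at h0 h1 hbase
  refine ⟨p (Sum.inl (Fin.castSucc (0 : Fin 2))), p (Sum.inl (Fin.castSucc (1 : Fin 2))), ?_, ?_⟩
  · rw [← e0, h0, e2, hbase]
  · rw [← e1, h1, e2, hbase]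

end Example

end Summit.Schanuel.Schanuel.Theorems

end
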